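import Mathlib
import HarnessLib
import Summits.ValiantsHypothesis.ValiantsHypothesis.Theses.MonotoneRestoration
import Literature.Computability.AlgebraicComplexity.ArithCircuit
import Literature.Computability.AlgebraicComplexity.ArithCircuitProofs
import Literature.Computability.AlgebraicComplexity.MonotoneStructure
import Literature.Computability.AlgebraicComplexity.PermanentIrreducible
import Literature.ModelTheory.FiniteModelTheory.CkEquiv
import Summits.ValiantsHypothesis.ValiantsHypothesis.Theorems.MonotoneRestorationMonotoneRestorationQPCosetCount
import Summits.ValiantsHypothesis.ValiantsHypothesis.Theorems.MonotoneRestorationMonotoneRestorationQPSymmetricLB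
import Summits.ValiantsHypothesis.ValiantsHypothesis.Theorems.MonotoneRestorationMonotoneRestorationQPSupportSymmetrisation
import Summits.ValiantsHypothesis.ValiantsHypothesis.Theorems.MonotoneRestorationMonotoneRestorationQPSparseRegime
import Summits.ValiantsHypothesis.ValiantsHypothesis.Theorems.MonotoneRestorationMonotoneRestorationQPBeta
import Literature.Computability.AlgebraicComplexity.SymmetricArithCircuit
import Literature.Computability.AlgebraicComplexity.DawarWilsenach2025Proofs
import Literature.GroupTheory.PermutationGroups.SmallIndexSubgroups
import Summits.ValiantsHypothesis.ValiantsHypothesis.Theorems.MonotoneRestorationQP.Negative.LoadBearing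
import Summits.ValiantsHypothesis.ValiantsHypothesis.Theorems.MonotoneRestorationMonotoneRestorationQPPermSupportCount

/-! TTRL-lite variant V22072 of stmt-ValiantsHypothesis-15886 -/

-- `Summit.ValiantsHypothesis.ValiantsHypothesis.…` is the tree's mandated single-conjunct layout
-- (Sub = Summit), so the duplicated namespace component is intended.
set_option linter.dupNamespace false

namespace Summit.ValiantsHypothesis.ValiantsHypothesis.Theorems

open Summit.ValiantsHypothesis.ValiantsHypothesis.Theses.MonotoneRestoration
open Literature.Computability.AlgebraicComplexity

set_option exponentiation.threshold 512 in
/-- **TTRL-lite variant V22072** (`lemma_proposal`, boundary probe) of the registered stub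
`stub_gammaArithmetic` of the crux `MonotoneRestorationQP` (item `stmt-ValiantsHypothesis-15886`)
is FALSE: the proposed lemma claims that the quadratic-room condition
`((log₂ n + c)^c + 2)² ≤ n / 2` already forces `c² ≤ log₂ n`, but the true threshold in `log₂ n`
is sub-quadratic in `c`.  Witness: `c = 17`, `n = 2 ^ 281`; then `log₂ n = 281`,
`k = 298 ^ 17 + 2` satisfies `k * k ≤ 2 ^ 280 = n / 2` (indeed `298^17 < 2^139.8`), while
`c * c = 289 > 281`.  (For `c ≤ 16` the implication happens to hold, so the witness is minimal in
`c`.) -/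
theorem stub_gammaArithmetic_var22072_false :
    ¬ (∀ (c n : ℕ), ((Nat.log 2 n + c) ^ c + 2) * ((Nat.log 2 n + c) ^ c + 2) ≤ n / 2 →
        c * c ≤ Nat.log 2 n) := by
  intro h
  -- witness `c = 17`, `n = 2 ^ 281` (numerals of ~282 bits; the exponentiation threshold is
  -- raised above 281 so that `norm_num` evaluates `2 ^ 281`).
  have h1 := h 17 (2 ^ 281)
  rw [Nat.log_pow Nat.one_lt_two] at h1
  have h2 : ((281 + 17) ^ 17 + 2) * ((281 + 17) ^ 17 + 2) ≤ (2 : ℕ) ^ 281 / 2 := by norm_num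
  have h3 := h1 h2
  omega

end Summit.ValiantsHypothesis.ValiantsHypothesis.Theorems
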